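import Mathlib
import HarnessLib
import Summits.QuantumFields.YangMills.Theses.PencilRigidity
import Summits.QuantumFields.YangMills.Theorems.PencilRigidityCurvatureKernelBoundLatticeWindowTransferLemmas
import Summits.QuantumFields.YangMills.Theorems.PencilRigidityCurvatureKernelBoundBoundedRenormalisationAxialGrowth

/-!
# `CurvatureKernelBound` — stub L3 `LatticeWindowTransfer` (support for stmt-QuantumFields-11687)

Crux `stmt-QuantumFields-11687` (`PencilRigidity.CurvatureKernelBound`), line `sixteen-charts-analytic-kernel`, stub L3
(skeleton v8). **Statement.** For `W₁`-data `(r, sch, S₁)` and a LATTICE WINDOW BOUND — frequently in `k`, for all sites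
`x, y` of the box with `R₀ ≤ ‖x − y‖` and `a_k ‖x − y‖ ≤ θ`,
`c_k² |Cov_k(Q_x, Q_y)| ≤ C (a_k ‖x − y‖)^(η−10)`, `Q_x(U) = r.curvature.F (configShift (−x) (torusLift side_k U))` under Wilson's
torus measure at step `k` — every kernel `K` continuous off `0` representing `S₁ 2` on `⁰𝒮₂` obeys the axial growth bound
`‖K(s e₀)‖ ≤ C' s^(η'−10)` on `(0, 1]` (`η' = min η 10`).

**Route** (as in L2 `BoundedRenormalisationAxialGrowth`, with the crude covariance bound replaced by the window bound).
Fix `0 < s ≤ s₀ = min 1 (2θ/3)`, `ξ = s e₀`, a continuity radius `ρ` of `K` at `ξ` (oscillation `< 1`), `ε = min(ρ, s)/4`, and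
standard bumps `g`, `h` of radii `(ε/2, ε)` at `ξ` and `0`. (1) The truncated lattice two-point function is the double sum
`c_k² a_k⁸ Σ_x Σ_y g(a_k x) h(a_k y) Cov_k(Q_x, Q_y)` (`abs_truncated_le_of_cov_le`); a contributing pair has
`a_k ‖x − y‖ ∈ (s/2, 3s/2)`, hence lies in the window once `a_k R₀ ≤ s/2`, and there
`C t^(η−10) ≤ Cp (3/2)^η 2¹⁰ s^(η−10) =: D` (`rpow_window_le`); with the lattice point count `R_k ≤ (3ε)⁴` this gives, along the good
subsequence, `|LS₂ − LS₁ LS₁| ≤ D (3ε)⁸`, and the lattice tie (`n = 2, 1`) passes it to `‖S₁ 2 (g⊗h) − S₁ 1 g · S₁ 1 h‖`.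
(2) `S₁ 1 = κ∫`. (3) Bump localisation `‖S₁ 2 (g⊗h) − K(ξ)(∫g)(∫h)‖ ≤ (∫g)(∫h)` and `∫g, ∫h ≥ (ε/2)⁴ v₁` give
`‖K(s e₀)‖ ≤ ‖κ‖² + 1 + D 6⁸ / v₁²`. (4) On `[s₀, 1]` continuity of `K` on the compact axial segment bounds it; `s^(η−10) ≤ s^(η'−10)`
and `1 ≤ s^(η'−10)` on `(0,1]` assemble the constant. [folklore]
-/

noncomputable section

open scoped BigOperators Topology SchwartzMap ComplexConjugate
open MeasureTheory Filter Set
open Literature.MathematicalPhysics.QuantumLattice Literature.MathematicalPhysics.AQFT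
open Literature.MathematicalPhysics.QuantumFieldTheory
open Literature.Probability.LatticeModels (Site box mem_box)
open Summit.QuantumFields.YangMills.Theorems.StrongCouplingIRTrivial.TwoPoint

namespace Summit.QuantumFields.YangMills.Theorems.CurvatureKernel


open LatticeWindow BoundedRenormalisation in
/-- **`LatticeWindowTransfer`** (Stub L3 of line `sixteen-charts-analytic-kernel`, crux `PencilRigidity.CurvatureKernelBound`,
registered signature verbatim). For `W₁`-data `(r, sch, S₁)` with the lattice window bound — frequently in `k`, for all sites
`x, y` of the box with `R₀ ≤ ‖x−y‖`, `a_k‖x−y‖ ≤ θ`: `c_k² |Cov_k(Q_x,Q_y)| ≤ C (a_k‖x−y‖)^(η−10)` — every kernel `K` continuous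
off `0` representing `S₁ 2` on `⁰𝒮₂` obeys `‖K(s e₀)‖ ≤ C' s^(min η 10 − 10)` on `(0,1]`. [folklore] -/
theorem LatticeWindowTransfer : open Literature.MathematicalPhysics.QuantumLattice Literature.MathematicalPhysics.AQFT Literature.MathematicalPhysics.QuantumFieldTheory in ∀ (G : Type) [Group G] [TopologicalSpace G] [IsTopologicalGroup G] [CompactSpace G] [MeasurableSpace G] [BorelSpace G], IsCompactSimpleLieGroup G → ∀ (r : LatticeRep G) (sch : SpeciesScheme (YMSpecies G)) (S₁ : SchwingerFamily (EuclideanSpace ℝ (Fin 4))), ((∀ (n : ℕ), n ≠ 0 → ∀ (f : Fin n → SchwartzMap (EuclideanSpace ℝ (Fin 4)) ℝ) (F : SchwartzMap (Fin n → (EuclideanSpace ℝ (Fin 4))) ℂ), IsTensorOf F (fun i => ofRealTest (f i)) → IsOffDiagonal F → Filter.Tendsto (fun k : ℕ => ((latticeSchwinger r.ρ sch (fun s => s.F) k n (fun _ => r.curvature) f : ℝ) : ℂ)) Filter.atTop (nhds (S₁ n F))) ∧ (S₁.toLabelled.IsNormalized ∧ S₁.toLabelled.IsHermitian ∧ S₁.toLabelled.HasLinearGrowth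 ∧ S₁.toLabelled.IsReflectionPositive ∧ S₁.toLabelled.IsSymmetric ∧ S₁.toLabelled.HasClusterProperty) ∧ (∀ (n : ℕ) (a : (EuclideanSpace ℝ (Fin 4))) (F : SchwartzMap (Fin n → (EuclideanSpace ℝ (Fin 4))) ℂ), IsOffDiagonal F → S₁ n (translateMulti a F) = S₁ n F) ∧ (∀ (R : (EuclideanSpace ℝ (Fin 4)) ≃ₗᵢ[ℝ] (EuclideanSpace ℝ (Fin 4))), LinearMap.det (R.toLinearEquiv : (EuclideanSpace ℝ (Fin 4)) →ₗ[ℝ] (EuclideanSpace ℝ (Fin 4))) = 1 → (∀ i : Fin 4, ∃ j : Fin 4, R (EuclideanSpace.single i 1) = EuclideanSpace.single j 1 ∨ R (EuclideanSpace.single i 1) = -EuclideanSpace.single j 1) → ∀ (n : ℕ) (F : SchwartzMap (Fin n → (EuclideanSpace ℝ (Fin 4))) ℂ), IsOffDiagonal F → S₁ n (linActMulti R F) = S₁ n F) ∧ (∃ Δ : ℝ, 0 < Δ ∧ S₁.toLabelled.HasMassGap Δ ∧ HasLatticeMassGap r sch Δ)) → (∃ (C η θ R₀ : ℝ), 0 <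 η ∧ 0 < θ ∧ ∃ᶠ k in Filter.atTop, ∀ x y : Literature.Probability.LatticeModels.Site 4, x ∈ Literature.Probability.LatticeModels.box 4 (sch.L k) → y ∈ Literature.Probability.LatticeModels.box 4 (sch.L k) → R₀ ≤ ‖siteToE x - siteToE y‖ → sch.a k * ‖siteToE x - siteToE y‖ ≤ θ → (sch.c r.curvature k) ^ 2 * |(∫ U, r.curvature.F (configShift (-x) (torusLift (sch.side k) U)) * r.curvature.F (configShift (-y) (torusLift (sch.side k) U)) ∂(wilsonMeasure r.ρ (sch.β k) : MeasureTheory.Measure (GaugeConfig 4 (sch.side k) G))) - (∫ U, r.curvature.F (configShift (-x) (torusLift (sch.side k) U)) ∂(wilsonMeasure r.ρ (sch.β k) : MeasureTheory.Measure (GaugeConfig 4 (sch.side k) G))) * (∫ U, r.curvature.F (configShift (-y) (torusLift (sch.side k) U)) ∂(wilsonMeasure r.ρ (sch.β k) : MeasureTheory.Measure (GaugeConfig 4 (sch.side k) G)))| ≤ C * (sch.a k * ‖siteToE x - siteToE y‖) ^ (η - 10)) → ∀ (K : (EuclideanSpace ℝ (Fin 4)) → ℂ), ContinuousOn K {x :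 (EuclideanSpace ℝ (Fin 4)) | x ≠ 0} → (∀ F : SchwartzMap (Fin 2 → (EuclideanSpace ℝ (Fin 4))) ℂ, IsOffDiagonal F → MeasureTheory.Integrable (fun x : Fin 2 → (EuclideanSpace ℝ (Fin 4)) => K (x 0 - x 1) * F x) ∧ S₁ 2 F = ∫ x : Fin 2 → (EuclideanSpace ℝ (Fin 4)), K (x 0 - x 1) * F x) → ∃ C η : ℝ, 0 < η ∧ ∀ s : ℝ, 0 < s → s ≤ 1 → ‖K (EuclideanSpace.single 0 s)‖ ≤ C * s ^ (η - 10) := by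
  intro G _ _ _ _ _ _ _ r sch S₁ hW₁ hwin K hcont hrep
  obtain ⟨htie, -, htr, -, -⟩ := hW₁
  obtain ⟨C, η, θ, R₀, hη, hθ, hfreq⟩ := hwin
  obtain ⟨κ, hκ⟩ := exists_degreeOne_eq_const_mul_realIntegral S₁ htr
  -- a subsequence along which the window bound holds
  obtain ⟨φ, hφmono, hφW⟩ := Filter.extraction_of_frequently_atTop hfreq
  have hφa : Tendsto (fun j => sch.a (φ j)) atTop (𝓝 0) := sch.tendsto_a.comp hφmono.tendsto_atTop
  -- Lebesgue measure on `(ℝ⁴)²` has temperate growth (Schwartz functions are integrable)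
  haveI : (volume : Measure (Fin 2 → EuclideanSpace ℝ (Fin 4))).HasTemperateGrowth :=
    Measure.IsAddHaarMeasure.instHasTemperateGrowth
  -- the volume of the unit ball
  obtain ⟨v₁, hv₁def⟩ : ∃ v : ℝ, (volume : Measure (EuclideanSpace ℝ (Fin 4))).real
      (Metric.closedBall (0 : EuclideanSpace ℝ (Fin 4)) 1) = v := ⟨_, rfl⟩
  have hv₁ : 0 < v₁ := by
    rw [← hv₁def]
    exact ENNReal.toReal_pos (Metric.measure_closedBall_pos volume _ one_pos).ne'
      measure_closedBall_lt_top.ne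
  -- constants
  set Cp : ℝ := max C 0 with hCp
  have hCpnn : 0 ≤ Cp := le_max_right _ _
  set Q : ℝ := Cp * ((3 / 2) ^ η * 2 ^ (10 : ℝ)) with hQ
  have hQnn : 0 ≤ Q := by positivity
  set s₀ : ℝ := min 1 (2 * θ / 3) with hs₀
  have hs₀pos : 0 < s₀ := lt_min one_pos (by linarith)
  have hs₀le : s₀ ≤ 1 := min_le_left _ _
  -- ### the bound near the origin: `0 < s ≤ s₀`
  have hsmall : ∀ s : ℝ, 0 < s → s ≤ s₀ →
      ‖K (EuclideanSpace.single 0 s)‖ ≤ ‖κ‖ ^ 2 + 1 + (Q * s ^ (η - 10)) * 6 ^ 8 / v₁ ^ 2 := by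
    intro s hs hss₀
    have hsθ : 3 * s / 2 ≤ θ := by
      have : s ≤ 2 * θ / 3 := hss₀.trans (min_le_right _ _)
      linarith
    set ξ : EuclideanSpace ℝ (Fin 4) := EuclideanSpace.single 0 s with hξdef
    have hnξ : ‖ξ‖ = s := by
      rw [hξdef, PiLp.norm_single, Real.norm_of_nonneg hs.le]
    have hξ : ξ ≠ 0 := fun h0 => hs.ne' ((PiLp.single_eq_zero_iff 2 _).1 h0)
    have hn0 : 0 < ‖ξ‖ := norm_pos_iff.2 hξ
    -- a continuity radius of `K` at `ξ`
    have hKat : ContinuousAt K ξ := (hcont ξ hξ).continuousAt (isOpen_compl_singleton.mem_nhds hξ)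
    obtain ⟨ρ, hρ, hρK⟩ := Metric.continuousAt_iff.1 hKat 1 one_pos
    have hρK' : ∀ z : EuclideanSpace ℝ (Fin 4), dist z ξ < ρ → dist (K z) (K ξ) < 1 :=
      fun z hz => hρK hz
    -- the bumps, of radii `(ε/2, ε)` with `ε = min(ρ, ‖ξ‖)/4`, and the tensors
    obtain ⟨ε, hε, hερ, hεξ⟩ : ∃ ε : ℝ, 0 < ε ∧ ε ≤ ρ / 4 ∧ ε ≤ ‖ξ‖ / 4 :=
      ⟨min (ρ / 4) (‖ξ‖ / 4), lt_min (by linarith) (by linarith), min_le_left _ _, min_le_right _ _⟩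
    let g : ContDiffBump ξ := ⟨ε / 2, ε, by linarith, by linarith⟩
    let h : ContDiffBump (0 : EuclideanSpace ℝ (Fin 4)) := ⟨ε / 2, ε, by linarith, by linarith⟩
    have hgr : g.rOut = ε := rfl
    have hhr : h.rOut = ε := rfl
    let gS : 𝓢(EuclideanSpace ℝ (Fin 4), ℝ) := g.hasCompactSupport.toSchwartzMap g.contDiff
    let hS : 𝓢(EuclideanSpace ℝ (Fin 4), ℝ) := h.hasCompactSupport.toSchwartzMap h.contDiff
    have gS_apply : ∀ x, gS x = g x := fun _ => rfl
    have hS_apply : ∀ x, hS x = h x := fun _ => rfl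
    let F : 𝓢((Fin 2 → EuclideanSpace ℝ (Fin 4)), ℂ) := SchwartzMap.tensorFin 2 ![ofRealTest gS, ofRealTest hS]
    have F_apply : ∀ x : Fin 2 → EuclideanSpace ℝ (Fin 4), F x = ((g (x 0) * h (x 1) : ℝ) : ℂ) := by
      intro x
      rw [tensorFin_two_apply, ofRealTest_apply, ofRealTest_apply, gS_apply, hS_apply]
      push_cast
      rfl
    have hFt : IsTensorOf F (fun i => ofRealTest (![gS, hS] i)) := isTensorOf_tensorFin_two_ofRealTest gS hS
    have hFoff : IsOffDiagonal F := isOffDiagonal_tensorFin_two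
      (disjoint_tsupport_of_bumps hεξ hn0 g h hgr hhr gS hS gS_apply hS_apply)
    obtain ⟨F₀, hF₀⟩ := exists_isTensorOf (n := 1) (fun _ : Fin 1 => ofRealTest gS)
    obtain ⟨F₁, hF₁⟩ := exists_isTensorOf (n := 1) (fun _ : Fin 1 => ofRealTest hS)
    -- the integrals of the bumps dominate the volume of the inner balls
    have hI₀ : (ε / 2) ^ 4 * v₁ ≤ ∫ y, g y := by
      have h1 := rIn_pow_mul_le_integral g
      rwa [hv₁def] at h1
    have hI₁ : (ε / 2) ^ 4 * v₁ ≤ ∫ y, h y := by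
      have h1 := rIn_pow_mul_le_integral h
      rwa [hv₁def] at h1
    -- (1) lattice side: the per-pair covariance bound along the good subsequence
    set D : ℝ := Q * s ^ (η - 10) with hDdef
    have hDnn : 0 ≤ D := mul_nonneg hQnn (Real.rpow_nonneg hs.le _)
    have hsmallmesh : ∀ᶠ j in atTop, sch.a (φ j) < ε ∧ sch.a (φ j) * R₀ < s / 2 := by
      refine (hφa.eventually (gt_mem_nhds hε)).and ?_
      have ht : Tendsto (fun j => sch.a (φ j) * R₀) atTop (𝓝 (0 * R₀)) := hφa.mul_const R₀
      rw [zero_mul] at ht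
      exact ht.eventually (gt_mem_nhds (half_pos hs))
    have hlat : ∀ᶠ j in atTop,
        ‖((latticeSchwinger r.ρ sch (fun s => s.F) (φ j) 2 (fun _ => r.curvature) ![gS, hS] : ℝ) : ℂ) -
          ((latticeSchwinger r.ρ sch (fun s => s.F) (φ j) 1 (fun _ => r.curvature) (fun _ => gS) : ℝ) : ℂ) *
          ((latticeSchwinger r.ρ sch (fun s => s.F) (φ j) 1 (fun _ => r.curvature) (fun _ => hS) : ℝ) : ℂ)‖ ≤
        D * (3 * ε) ^ 4 * (3 * ε) ^ 4 := by
      filter_upwards [hsmallmesh] with j hj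
      obtain ⟨hjε, hjR⟩ := hj
      set k := φ j with hk
      have hak : 0 < sch.a k := sch.a_pos k
      -- the per-pair bound for contributing pairs
      have hpair : ∀ x ∈ box 4 (sch.L k), ∀ y ∈ box 4 (sch.L k),
          (![gS, hS] : Fin 2 → 𝓢(EuclideanSpace ℝ (Fin 4), ℝ)) 0 (sch.a k • siteToE x) ≠ 0 →
          (![gS, hS] : Fin 2 → 𝓢(EuclideanSpace ℝ (Fin 4), ℝ)) 1 (sch.a k • siteToE y) ≠ 0 →
            (sch.c r.curvature k) ^ 2 *
              |(∫ U, r.curvature.F (configShift (-x) (torusLift (sch.side k) U)) *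
                  r.curvature.F (configShift (-y) (torusLift (sch.side k) U))
                  ∂(wilsonMeasure r.ρ (sch.β k) : MeasureTheory.Measure (GaugeConfig 4 (sch.side k) G))) -
                (∫ U, r.curvature.F (configShift (-x) (torusLift (sch.side k) U))
                  ∂(wilsonMeasure r.ρ (sch.β k) : MeasureTheory.Measure (GaugeConfig 4 (sch.side k) G))) *
                (∫ U, r.curvature.F (configShift (-y) (torusLift (sch.side k) U))
                  ∂(wilsonMeasure r.ρ (sch.β k) : MeasureTheory.Measure (GaugeConfig 4 (sch.side k) G)))| ≤ D := by
        intro x hx y hy hgx hhy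
        simp only [Matrix.cons_val_zero, Matrix.cons_val_one] at hgx hhy
        rw [gS_apply] at hgx
        rw [hS_apply] at hhy
        have hgx' : dist (sch.a k • siteToE x) ξ < ε := by
          rw [← hgr]; exact lt_of_not_ge fun h' => hgx (g.zero_of_le_dist h')
        have hhy' : ‖sch.a k • siteToE y‖ < ε := by
          have := lt_of_not_ge fun h' => hhy (h.zero_of_le_dist h')
          rwa [hhr, dist_zero_right] at this
        obtain ⟨hw1, hw2⟩ := norm_sub_mem_window hgx' hhy' hεξ
        rw [← smul_sub, norm_smul, Real.norm_of_nonneg hak.le, hnξ] at hw1 hw2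
        -- the pair lies in the window
        have hR : R₀ ≤ ‖siteToE x - siteToE y‖ := by
          by_contra hlt
          push Not at hlt
          have : sch.a k * ‖siteToE x - siteToE y‖ ≤ sch.a k * R₀ :=
            mul_le_mul_of_nonneg_left hlt.le hak.le
          linarith
        have hθ' : sch.a k * ‖siteToE x - siteToE y‖ ≤ θ := by linarith
        have hwin := hφW j x y hx hy hR hθ'
        rw [← hk] at hwin
        refine hwin.trans ?_
        have htpos : 0 < sch.a k * ‖siteToE x - siteToE y‖ := by linarith
        have hpow := rpow_window_le hη hs hw1.le (by linarith)
        calc C * (sch.a k * ‖siteToE x - siteToE y‖) ^ (η - 10)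
            ≤ Cp * (sch.a k * ‖siteToE x - siteToE y‖) ^ (η - 10) :=
              mul_le_mul_of_nonneg_right (le_max_left _ _) (Real.rpow_nonneg htpos.le _)
          _ ≤ Cp * ((3 / 2) ^ η * 2 ^ (10 : ℝ) * s ^ (η - 10)) := mul_le_mul_of_nonneg_left hpow hCpnn
          _ = D := by rw [hDdef, hQ]; ring
      have hL := abs_truncated_le_of_cov_le r sch r.curvature k ![gS, hS] hpair
      simp only [Matrix.cons_val_zero, Matrix.cons_val_one] at hL
      have hRg := latticeSum_bump_le g gS_apply hak (hgr ▸ hjε.le) (sch.L k)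
      have hRh := latticeSum_bump_le h hS_apply hak (hhr ▸ hjε.le) (sch.L k)
      rw [hgr] at hRg
      rw [hhr] at hRh
      rw [← Complex.ofReal_mul, ← Complex.ofReal_sub, Complex.norm_real, Real.norm_eq_abs]
      refine hL.trans ?_
      gcongr
    -- the lattice tie along the subsequence
    have hu := (htie 2 two_ne_zero ![gS, hS] F hFt hFoff).comp hφmono.tendsto_atTop
    have hv := (htie 1 one_ne_zero (fun _ => gS) F₀ hF₀
      (HypercubicLimit.Negative.isOffDiagonal_fin_one F₀)).comp hφmono.tendsto_atTop
    have hw := (htie 1 one_ne_zero (fun _ => hS) F₁ hF₁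
      (HypercubicLimit.Negative.isOffDiagonal_fin_one F₁)).comp hφmono.tendsto_atTop
    have hZ : ‖S₁ 2 F - S₁ 1 F₀ * S₁ 1 F₁‖ ≤ D * (3 * ε) ^ 4 * (3 * ε) ^ 4 :=
      le_of_tendsto (hu.sub (hv.mul hw)).norm hlat
    -- (2) the disconnected part is `κ² (∫g)(∫h)`
    have hS1F₀ : S₁ 1 F₀ = κ * ((∫ y, g y : ℝ) : ℂ) := hκ gS F₀ hF₀
    have hS1F₁ : S₁ 1 F₁ = κ * ((∫ y, h y : ℝ) : ℂ) := hκ hS F₁ hF₁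
    rw [hS1F₀, hS1F₁] at hZ
    -- (3) continuum side: bump localisation of the representing kernel; (4) algebra
    obtain ⟨hint, hS2⟩ := hrep F hFoff
    have hsum : g.rOut + h.rOut ≤ ρ := by
      show ε + ε ≤ ρ
      linarith
    have h2 := norm_integral_kernel_bumps_sub_le hρK' g h hsum F_apply F.integrable hint
    rw [← hS2, norm_sub_rev] at h2
    have := LatticeWindow.norm_le_of_estimates hv₁ hε hDnn hI₀ hI₁ hZ h2
    simpa only [hDdef, mul_div_assoc] using this
  -- ### the bound on `[s₀, 1]` by continuity, and assembly
  obtain ⟨M, hM0, hM⟩ := exists_bound_on_axial_segment hcont hs₀pos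
  set η' : ℝ := min η 10 with hη'
  have hη'pos : 0 < η' := lt_min hη (by norm_num)
  have hη'le : η' ≤ η := min_le_left _ _
  have hη'10 : η' - 10 ≤ 0 := by linarith [min_le_right η 10]
  refine ⟨‖κ‖ ^ 2 + 1 + Q * 6 ^ 8 / v₁ ^ 2 + M, η', hη'pos, fun s hs hs1 => ?_⟩
  -- on `(0,1]`: `1 ≤ s^(η'-10)` and `s^(η-10) ≤ s^(η'-10)`
  have hone : 1 ≤ s ^ (η' - 10) := Real.one_le_rpow_of_pos_of_le_one_of_nonpos hs hs1 hη'10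
  have hmono : s ^ (η - 10) ≤ s ^ (η' - 10) :=
    Real.rpow_le_rpow_of_exponent_ge hs hs1 (by linarith)
  have hA : 0 ≤ ‖κ‖ ^ 2 + 1 := by positivity
  have hB : 0 ≤ Q * 6 ^ 8 / v₁ ^ 2 := by positivity
  by_cases hcase : s ≤ s₀
  · have h1 := hsmall s hs hcase
    calc ‖K (EuclideanSpace.single 0 s)‖ ≤ ‖κ‖ ^ 2 + 1 + (Q * s ^ (η - 10)) * 6 ^ 8 / v₁ ^ 2 := h1
      _ = (‖κ‖ ^ 2 + 1) * 1 + (Q * 6 ^ 8 / v₁ ^ 2) * s ^ (η - 10) := by ring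
      _ ≤ (‖κ‖ ^ 2 + 1) * s ^ (η' - 10) + (Q * 6 ^ 8 / v₁ ^ 2) * s ^ (η' - 10) + M * s ^ (η' - 10) := by
          nlinarith [mul_le_mul_of_nonneg_left hone hA, mul_le_mul_of_nonneg_left hmono hB,
            mul_nonneg hM0 (zero_le_one.trans hone)]
      _ = (‖κ‖ ^ 2 + 1 + Q * 6 ^ 8 / v₁ ^ 2 + M) * s ^ (η' - 10) := by ring
  · have hs₀s : s₀ ≤ s := (lt_of_not_ge hcase).le
    have h1 := hM s hs₀s hs1
    calc ‖K (EuclideanSpace.single 0 s)‖ ≤ M := h1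
      _ = M * 1 := (mul_one M).symm
      _ ≤ M * s ^ (η' - 10) + (‖κ‖ ^ 2 + 1) * s ^ (η' - 10) + (Q * 6 ^ 8 / v₁ ^ 2) * s ^ (η' - 10) := by
          nlinarith [mul_le_mul_of_nonneg_left hone hM0, mul_nonneg hA (zero_le_one.trans hone),
            mul_nonneg hB (zero_le_one.trans hone)]
      _ = (‖κ‖ ^ 2 + 1 + Q * 6 ^ 8 / v₁ ^ 2 + M) * s ^ (η' - 10) := by ring

end Summit.QuantumFields.YangMills.Theorems.CurvatureKernel

end
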